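import Summits.Ventures.AbcSig.Conjectures.LevelRaising32L2Instances
import Summits.Ventures.AbcSig.Levels.N224
import Summits.Ventures.AbcSig.Levels.N736
import Summits.Ventures.AbcSig.Levels.N992

/-!
# Venture AbcSig — `CONJ_LR32_L2` at the out-of-sample held levels `2⁵ℓ`, `ℓ ∈ {7, 23, 31}`: two vacuous slices and the `ℓ = 7` Frey pair

HONEST FRAMING. Support file of the computation cell `pub-abcsig`, companion of `Conjectures/LevelRaising32L2Instances.lean`
(p495825). `CONJ_LR32_L2` (p490111) is a CONJECTURE over the abstract `NewformModel`; nothing here proves it or adds evidence for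
its content. Proved here, modulo the COMPUTED hypothesis `NewformModel.DataComplete` of the level files `Levels/N736.lean`,
`Levels/N992.lean` (engine-1 modular-symbol files of record + trace-formula certificate AGREE-STURM; no second orbit file exists for
these two levels) and NOTHING ELSE: the slices `CONJ_LR32_L2At M 23` and `CONJ_LR32_L2At M 31` (levels `736 = 2⁵·23`,
`992 = 2⁵·31`). Like the four in-sample slices `ℓ ∈ {11, 13, 19, 29}` they hold VACUOUSLY: the kernel sieve certificates leave
residual exponent unions `[7]`, `[7]` over `8 + 8` orbits (degrees `2,2,2,2,3,3,4,4` and `2,2,3,3,4,4,6,6`, no rational orbit), so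
at every prime `n ≥ 11` no newform of these levels passes even the coarse [BS04, Lemma 4.2] sieve and the premise is never met.
`ℓ = 23, 31` carry no pseudo-solution and lie OUTSIDE the census range `ℓ ≥ 43` of the law's in-sample evidence.

THE LEVEL `224 = 2⁵·7` IS DIFFERENT — ERRATUM to the sentence «out-of-sample survivor-free levels `ℓ ∈ {7, 23, 31}`» in the module
docstring of `LevelRaising32L2Instances.lean`: `ℓ = 7` carries the pseudo-solution `7·(−1)ⁿ + 8·1ⁿ = 1²` (every odd `n`), datum
`S± = (A, B, C; n; a, b, c) = (7, 8, 1; n; −1, 1, ±1)`, `|ab| = 1`, `AB = 2³·7`, Kraus class `(E₂, 7, 8) ∈ lr32Classes 7 n`; its Frey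
curves in the model `E₂` are `Y² = X³ ± X² + 2X` (a `χ₋₄`-twist pair, conductor `224`), and the two RATIONAL orbits `224.2` (`c = +1`)
and `224.1` (`c = −1`) of `Levels/N224.lean` have EXACTLY these curves' traces at the 16 listed primes — checked in the kernel below
(`orbit_224_2_eq_freyTrace`, `orbit_224_1_eq_freyTrace`, the tree's `freyTrace` by naive point count) — and pass the coarse sieve at
every exponent (they are listed as NOT ELIMINABLE in the level file). So no slice at `ℓ = 7` is provable from the level file: the
typed conclusion `CongruentToFrey M f n .E2 S±` for the newforms matching `224.1 / 224.2` is the intended reading (the registered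
test found `c_q` identical at every good prime of the files, "P21″ by identity") but quantifies over ALL primes, which finite orbit
data cannot deliver, and the interface has no multiplicity-one axiom pinning a matching newform to the Frey form. This file states
that boundary; it does not cross it.

Context: the registered instrument test «E2-LR32-R2» of the typed law on the twelve held files `2⁵ℓ`, `ℓ ≤ 41`
(HOME/lead/PREDICTIONS-ODDHALVES-lead-g14.md registrar l.81–l.83; engine-2 g28 HIT 12/12, engine-1 g19 second hand CONCUR 12/12,
referee ref-g85 pre-audit, bench g23 third hand): outside `R₃₂(ℓ)` nothing but the 16 pseudo-solution Frey forms survives `n ≥ 17`,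
and those by identity; the six survivor-free levels `ℓ ∈ {11, 13, 19, 23, 29, 31}` are now kernel slices (four in the companion file,
two here); the six pseudo-solution levels `ℓ ∈ {3, 5, 7, 17, 37, 41}` are not. Lead g18 RULING «L2-SLICES-OOS» (HOME/INBOX
2026-08-27T04:35:56Z). Nothing here is a claim on ABC or any summit.

References: [BS04] M. A. Bennett, C. M. Skinner, Canad. J. Math. 56 (2004) 23–54, p. 27, Lemma 2.1, Lemma 4.2. Cell records: HOME =
run/shared/lean/pub/pub-abcsig/: engine/engine-2/results/LR32-R2-g28/ (521a6a8f7ec6c7bc), engine/engine1-0.5/notes-g19/r2/,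
referee/ref-g85/REF-PREAUDIT-LR32-R2-g85.md (64cfc7627b61d429), plean/g15/LR32-R2-ELL7-NOTE-plean-g15.md (03c2f1ed7acf2b01).
-/

namespace Summit.Ventures.AbcSig.Conjectures

open Summit.Ventures.AbcSig

/-! ## The two out-of-sample survivor-free slices -/

/-- **`CONJ_LR32_L2` at `ℓ = 23` (level `736 = 2⁵·23`) holds in every model whose level-736 newforms are the 8 certified orbits
of `Levels/N736.lean`** (computed hypothesis `DataComplete`; residual exponents of the kernel certificates `⊆ {7}`, so at every
prime `n ≥ 17` no newform passes the coarse sieve — vacuous instance; `ℓ = 23` carries no pseudo-solution). -/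
theorem CONJ_LR32_L2At_23 (M : NewformModel) (hD : M.DataComplete 736 level736Orbits) : CONJ_LR32_L2At M 23 :=
  CONJ_LR32_L2At_of_eliminated M (by norm_num) hD level736_wellformed fun n hn h17 _ o ho =>
    ((level736_sieve n hn (by omega) (fun _ => False)
      (fun h => by simp only [List.mem_cons, List.not_mem_nil, or_false] at h; omega)
      (fun h => by simp only [List.mem_cons, List.not_mem_nil, or_false] at h; omega) o ho).2).elim id False.elim

/-- **`CONJ_LR32_L2` at `ℓ = 31` (level `992 = 2⁵·31`) holds in every model whose level-992 newforms are the 8 certified orbits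
of `Levels/N992.lean`** (computed hypothesis `DataComplete`; residual exponents `⊆ {7}` — vacuous instance; `ℓ = 31` carries no
pseudo-solution). -/
theorem CONJ_LR32_L2At_31 (M : NewformModel) (hD : M.DataComplete 992 level992Orbits) : CONJ_LR32_L2At M 31 :=
  CONJ_LR32_L2At_of_eliminated M (by norm_num) hD level992_wellformed fun n hn h17 _ o ho =>
    ((level992_sieve n hn (by omega) (fun _ => False)
      (fun h => by simp only [List.mem_cons, List.not_mem_nil, or_false] at h; omega)
      (fun h => by simp only [List.mem_cons, List.not_mem_nil, or_false] at h; omega) o ho).2).elim id False.elim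

/-! ## `ℓ = 7`: the two rational orbits of level 224 ARE the pseudo-solution Frey pair at the listed primes -/

/-- The pseudo-solution datum `7·(−1)ⁿ + 8·1ⁿ = 1²` at `ℓ = 7` with `c = +1` (exponent field set to `17`; `freyTrace` depends on
`n` only through `bⁿ = 1`). -/
def lr32PseudoDatum7pos : FreyDatum := ⟨7, 8, 1, 17, -1, 1, 1⟩

/-- The same datum with `c = −1` (the `χ₋₄`-twist). -/
def lr32PseudoDatum7neg : FreyDatum := ⟨7, 8, 1, 17, -1, 1, -1⟩

/-- Both data are primitive solutions of `7 x¹⁷ + 8 y¹⁷ = z²` in the sense of [BS04] (`|ab| = 1`: pseudo-solutions), and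
`(E₂, 7, 8)` is one of the Kraus classes `lr32Classes 7 17` (with `m = 1`). -/
theorem lr32PseudoDatum7_isPrimitiveSolution :
    IsPrimitiveSolution 7 8 1 17 lr32PseudoDatum7pos.a lr32PseudoDatum7pos.b lr32PseudoDatum7pos.c ∧
    IsPrimitiveSolution 7 8 1 17 lr32PseudoDatum7neg.a lr32PseudoDatum7neg.b lr32PseudoDatum7neg.c ∧
    (FreyModel.E2, 7, 8) ∈ lr32Classes 7 17 := by
  refine ⟨?_, ?_, by decide +kernel⟩ <;>
  · refine ⟨by decide, by decide, by decide, by decide, ?_, ?_, ?_⟩ <;>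
    first
    | exact (Int.isCoprime_iff_gcd_eq_one.mpr (by decide))

/-- **Orbit `224.2` = the Frey curve `E₂(S₊) : Y² = X³ + X² + 2X` at the listed primes**: every entry `(q, d, g)` of `orbit_224_2`
has `d = 1` and `g` = the constant `freyTrace .E2 S₊ q` (naive point count; trace `0` is the empty list in the level-file
encoding). Kernel check by evaluation. This is an identity at the 16 listed primes `q ≤ 61` only — NOT `CongruentToFrey`, which
quantifies over all primes. -/
theorem orbit_224_2_eq_freyTrace : ∀ e ∈ orbit_224_2.coeffs,
    e.d = 1 ∧ e.g = (if freyTrace .E2 lr32PseudoDatum7pos e.ell = 0 then [] else [freyTrace .E2 lr32PseudoDatum7pos e.ell]) := by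
  decide +kernel

/-- **Orbit `224.1` = the twist `E₂(S₋) : Y² = X³ − X² + 2X` at the listed primes** (same statement with `c = −1`). -/
theorem orbit_224_1_eq_freyTrace : ∀ e ∈ orbit_224_1.coeffs,
    e.d = 1 ∧ e.g = (if freyTrace .E2 lr32PseudoDatum7neg e.ell = 0 then [] else [freyTrace .E2 lr32PseudoDatum7neg e.ell]) := by
  decide +kernel

end Summit.Ventures.AbcSig.Conjectures
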